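import Summits.AtomisticToContinuum.BoseEinsteinCondensation.Theses.BECConjugateDomination
import Literature.MathematicalPhysics.QuantumManyBody.PeriodicBoseGasThm31
import Literature.MathematicalPhysics.QuantumManyBody.PeriodicBoseGasImpurityTranslation
import HarnessLib

/-!
# Close-pair domination (stub S1 of line `coupling-slope-pocket`) at the constant state:
# the positive core is load-bearing, and the constant is at least `(R/r₀)³/c₀`
(negative-side lemma for crux `PuffFloor`, stmt-AtomisticToContinuum-11785; cycle 3, Targets)

Cycle-3 file of the refuter's negative-side chain for crux `PuffFloor` of route
`BECConjugateDomination` (cdisprove seat gen 3, 2026-08-16). TARGET: the hardest stub of the picked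
line `Lines/coupling-slope-pocket.lean`,

  `stub_corePairDomination : ∀ c₀ r₀ R > 0, ∃ C ≥ 0, ∃ L₀ > 0, ∀ N, ∀ L ≥ L₀, ∀ Ψ,
     E_Ψ[#{i<j : ‖xᵢ - xⱼ - Lq‖ ≤ R some q}] ≤ C · ⟨Ψ, (-∑Δ + ∑_{i<j} (c₀ 1_{[0,r₀)})^per) Ψ⟩`

(Lee 2009 Thm 7, non-negative pair-count form). We evaluate both sides EXACTLY on the constant
two-particle state `Ψ ≡ L⁻³` of the torus (`constState`): the pair count is `|B̄_R|/L³`, the energy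
is `c₀ |B_{r₀}|/L³` (`pairCount_constState_two`, `coreEnergy_constState_two`, by unfolding the
periodisation on the cell, `lintegral_cell_periodizedPotential_sub`). Consequences:

* `corePairDomination_constState_necessary` — any constant `C` admissible in S1 (already for
  `N = 2` and one side length `L`) satisfies `|B̄_R| ≤ C c₀ |B_{r₀}|`, i.e.
  `corePairDomination_ratio_le : (R/r₀)³ ≤ C · c₀`. The dependence of Lee's constant on the core is
  therefore ESSENTIAL: no close-pair domination is uniform in the core height `c₀ → 0` or in the
  counting radius `R → ∞` (Lee: `C = 8/A`, `A = min(E′, c₀)/(2M)`, `M = ⌈√3ℓ/r₀⌉³`, `ℓ ≥ 4R` — the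
  right shape). Information for the lead: the `k ≥ 2M` pigeonhole branch cannot be spared.
* `corePairDomination_of_radius_lt_core` — conversely, for `R < r₀` S1 holds trivially with
  `C = 1/c₀` for every `N, L, Ψ` (each close pair is a core pair), so the constant-state bound is
  sharp at `R = r₀⁻` and S1's entire content is the regime `R > r₀` (close pairs outside the core,
  paid by kinetic energy only);
* `corePairDomination_false_without_core : ¬ CorePairDominationWithoutCore` — S1 with the
  hypothesis `0 < c₀` weakened to `0 ≤ c₀` (everything else byte for byte) is FALSE (`c₀ = 0`: the
  right-hand side is the kinetic energy, which the constant state does not have, while it has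
  `|B̄_R|/L³ > 0` close pairs). The positive core is load-bearing in S1; for the coreless members of
  the smooth class (`v 0 = 0`, e.g. `hollowShell` of `SmoothClassInhabitants.lean`) the line has no
  substitute (stub S5 is the scope residual).

No Theses statement is asserted positively. All `[folklore]`.
-/

noncomputable section

namespace Summit.AtomisticToContinuum.BoseEinsteinCondensation.Theorems.PuffFloor.Negative

open Literature.MathematicalPhysics.QuantumManyBody.BoseGas MeasureTheory Metric
open scoped ENNReal NNReal BigOperators

variable {N : ℕ} {L : ℝ}

/-! ### The constant periodic trial state `Ψ ≡ (L³)^{-N/2}` -/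

/-- The amplitude `(L³)^{-N/2}` of the normalised constant state. [folklore] -/
def constAmp (N : ℕ) (L : ℝ) : ℝ := (Real.sqrt ((L ^ 3) ^ N))⁻¹

/-- `|(L³)^{-N/2}|² = (L³)^{-N}` in `ℝ≥0∞`. [folklore] -/
theorem nnnorm_constAmp_sq (hL : 0 < L) :
    ((‖(constAmp N L : ℂ)‖₊ : ℝ≥0∞) ^ 2) = ENNReal.ofReal ((L ^ 3) ^ N)⁻¹ := by
  have hApos : 0 < (L ^ 3) ^ N := by positivity
  rw [← ENNReal.coe_pow, ENNReal.ofReal, ENNReal.coe_inj]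
  ext
  rw [NNReal.coe_pow, coe_nnnorm, Complex.norm_real, constAmp, norm_inv,
    Real.norm_of_nonneg (Real.sqrt_nonneg _), inv_pow, Real.sq_sqrt hApos.le,
    Real.coe_toNNReal _ (by positivity)]

/-- **The constant state** `Ψ ≡ (L³)^{-N/2}` on the torus of side `L > 0` (zero kinetic energy; the
free-gas minimiser). [folklore] -/
def constState (N : ℕ) (hL : 0 < L) : PeriodicTrialState N L where
  ψ := fun _ => (constAmp N L : ℂ)
  contDiff := contDiff_const
  periodic := fun _ _ _ => rfl
  symm := fun _ _ => rfl
  norm_eq := by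
    have hApos : 0 < (L ^ 3) ^ N := by positivity
    have hvolA : (ENNReal.ofReal L ^ 3) ^ N = ENNReal.ofReal ((L ^ 3) ^ N) := by
      rw [← ENNReal.ofReal_pow hL.le, ← ENNReal.ofReal_pow (by positivity)]
    rw [setLIntegral_const, volume_cellN, nnnorm_constAmp_sq hL, hvolA,
      ← ENNReal.ofReal_mul (inv_nonneg.2 hApos.le), inv_mul_cancel₀ hApos.ne', ENNReal.ofReal_one]

/-- The constant state's value. [folklore] -/
@[simp] theorem constState_apply (hL : 0 < L) (X : Config N) :
    (constState N hL).ψ X = (constAmp N L : ℂ) := rfl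

/-- A constant function has zero kinetic energy density. [folklore] -/
theorem kineticDensity_const (c : ℂ) (X : Config N) :
    kineticDensity (fun _ : Config N => c) X = 0 := by
  simp [kineticDensity]

/-- The expectation of a pair functional `∑_{i<j} w^per` in the constant state is its cell average:
`∫_{cell^N} (∑ w^per)·|Ψ|² = (L³)^{-N} ∫_{cell^N} ∑ w^per`. [folklore] -/
theorem pairExpectation_constState (w : ℝ → ℝ≥0∞) (hL : 0 < L) :
    (∫⁻ X in cellN N L, periodicInteraction w L X * (‖(constState N hL).ψ X‖₊ : ℝ≥0∞) ^ 2) =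
      (∫⁻ X in cellN N L, periodicInteraction w L X) * ENNReal.ofReal ((L ^ 3) ^ N)⁻¹ := by
  rw [← lintegral_mul_const' _ _ ENNReal.ofReal_ne_top]
  refine lintegral_congr fun X => ?_
  rw [constState_apply, nnnorm_constAmp_sq hL]

/-- The energy of the constant state is its (cell-averaged) interaction: no kinetic energy.
[folklore] -/
theorem periodicEnergy_constState (w : ℝ → ℝ≥0∞) (hL : 0 < L) :
    periodicEnergy w (constState N hL) =
      (∫⁻ X in cellN N L, periodicInteraction w L X) * ENNReal.ofReal ((L ^ 3) ^ N)⁻¹ := by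
  rw [← pairExpectation_constState w hL]
  unfold periodicEnergy
  refine lintegral_congr fun X => ?_
  change kineticDensity (fun _ : Config N => (constAmp N L : ℂ)) X + _ = _
  rw [kineticDensity_const, zero_add]

/-! ### Two particles: unfolding the periodisation on the cell -/

/-- The periodisation of a measurable profile is measurable. [folklore] -/
private theorem measurable_periodizedPotential' {w : ℝ → ℝ≥0∞} (hw : Measurable w) (L : ℝ) :
    Measurable (periodizedPotential w L) := by
  unfold periodizedPotential
  exact Measurable.tsum fun n => hw.comp (measurable_id.sub_const _).norm

/-- `∫_{cell^{n+1}} w^per(xᵢ - xⱼ) dX = (∫_{ℝ³} w(|y|)dy) · L^{3n}` for `i ≠ j` (slice integration in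
`xᵢ`, unfolding of the periodisation on the cell). Adapted verbatim from the line skeleton
`Lines/coupling-slope-pocket.lean` §EnergyUpperBound (itself from `Lines/sacrificial-edge-layer.lean`).
[folklore] -/
theorem lintegral_cellN_periodizedPotential_pair {w : ℝ → ℝ≥0∞} (hw : Measurable w) (hL : 0 < L)
    {n : ℕ} {i j : Fin (n + 1)} (hij : i ≠ j) :
    ∫⁻ X in cellN (n + 1) L, periodizedPotential w L (X i - X j) =
      (∫⁻ x : Space, w ‖x‖) * (ENNReal.ofReal L ^ 3) ^ n := by
  have hH : Measurable fun X : Config (n + 1) => periodizedPotential w L (X i - X j) :=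
    (measurable_periodizedPotential' hw L).comp ((measurable_pi_apply i).sub (measurable_pi_apply j))
  have key := lintegral_cellN_lintegral_update (L := L) i hH
  have hinner : ∀ X : Config (n + 1),
      (∫⁻ x in cell L, periodizedPotential w L (Function.update X i x i - Function.update X i x j)) =
        ∫⁻ y : Space, w ‖y‖ := by
    intro X
    simp only [Function.update_self, Function.update_of_ne hij.symm]
    exact lintegral_cell_periodizedPotential_sub hL hw (X j)
  simp only [hinner] at key
  rw [setLIntegral_const, volume_cellN, pow_succ, ← mul_assoc] at key
  have hV0 : (ENNReal.ofReal L ^ 3) ≠ 0 := pow_ne_zero _ ((ENNReal.ofReal_pos.2 hL).ne')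
  have hVt : (ENNReal.ofReal L ^ 3) ≠ ⊤ := ENNReal.pow_ne_top ENNReal.ofReal_ne_top
  have key' : (ENNReal.ofReal L ^ 3) * ((∫⁻ y : Space, w ‖y‖) * (ENNReal.ofReal L ^ 3) ^ n) =
      (ENNReal.ofReal L ^ 3) * ∫⁻ X in cellN (n + 1) L, periodizedPotential w L (X i - X j) := by
    rw [← key]; ring
  exact ((ENNReal.mul_right_inj hV0 hVt).1 key').symm

/-- For two particles the interaction has the single term `w^per(x₀ - x₁)`. [folklore] -/
theorem periodicInteraction_two (w : ℝ → ℝ≥0∞) (L : ℝ) (X : Config 2) :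
    periodicInteraction w L X = periodizedPotential w L (X 0 - X 1) := by
  have h0 : (Finset.univ.filter fun j : Fin 2 => (0 : Fin 2) < j) = {1} := by decide
  have h1 : (Finset.univ.filter fun j : Fin 2 => (1 : Fin 2) < j) = ∅ := by decide
  rw [periodicInteraction, Fin.sum_univ_two, h0, h1, Finset.sum_singleton, Finset.sum_empty, add_zero]

/-- `∫_{cell²} w^per(x₀ - x₁) = (∫_{ℝ³} w(|y|) dy) · L³`. [folklore] -/
theorem lintegral_cellN_two_periodicInteraction {w : ℝ → ℝ≥0∞} (hw : Measurable w) (hL : 0 < L) :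
    ∫⁻ X in cellN 2 L, periodicInteraction w L X = (∫⁻ y : Space, w ‖y‖) * ENNReal.ofReal L ^ 3 := by
  simp_rw [periodicInteraction_two]
  have h := lintegral_cellN_periodizedPotential_pair (n := 1) (i := 0) (j := 1) hw hL (by decide)
  rw [pow_one] at h
  exact h

/-! ### The two radial integrals: `∫ 1{|y| ≤ R} = |B̄_R|`, `∫ c₀ 1{|y| < r₀} = c₀ |B_{r₀}|` -/

/-- `∫_{ℝ³} 1{|y| ≤ R} dy = |B̄_R|`. [folklore] -/
theorem lintegral_indicator_Iic_norm (R : ℝ) :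
    ∫⁻ y : Space, Set.indicator (Set.Iic R) (fun _ : ℝ => (1 : ℝ≥0∞)) ‖y‖ =
      volume (closedBall (0 : Space) R) := by
  rw [← lintegral_indicator_one measurableSet_closedBall]
  refine lintegral_congr fun y => ?_
  by_cases hy : ‖y‖ ≤ R
  · rw [Set.indicator_of_mem (show ‖y‖ ∈ Set.Iic R from hy),
      Set.indicator_of_mem (mem_closedBall_zero_iff.2 hy), Pi.one_apply]
  · rw [Set.indicator_of_notMem (show ‖y‖ ∉ Set.Iic R from hy),
      Set.indicator_of_notMem (fun h => hy (mem_closedBall_zero_iff.1 h))]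

/-- `∫_{ℝ³} c·1{|y| < r₀} dy = c |B_{r₀}|`. [folklore] -/
theorem lintegral_indicator_Iio_norm (r₀ : ℝ) (c : ℝ≥0∞) :
    ∫⁻ y : Space, Set.indicator (Set.Iio r₀) (fun _ : ℝ => c) ‖y‖ = c * volume (ball (0 : Space) r₀) := by
  rw [← lintegral_indicator_const measurableSet_ball]
  refine lintegral_congr fun y => ?_
  by_cases hy : ‖y‖ < r₀
  · rw [Set.indicator_of_mem (show ‖y‖ ∈ Set.Iio r₀ from hy),
      Set.indicator_of_mem (mem_ball_zero_iff.2 hy)]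
  · rw [Set.indicator_of_notMem (show ‖y‖ ∉ Set.Iio r₀ from hy),
      Set.indicator_of_notMem (fun h => hy (mem_ball_zero_iff.1 h))]

/-- Indicator profiles are measurable. [folklore] -/
theorem measurable_indicator_const' (s : Set ℝ) (hs : MeasurableSet s) (c : ℝ≥0∞) :
    Measurable (Set.indicator s (fun _ : ℝ => c)) :=
  measurable_const.indicator hs

/-! ### Both sides of S1 at the constant two-particle state -/

/-- **Pair count of the constant state**: `E[#pairs at periodic distance ≤ R] = |B̄_R| · L³ · L⁻⁶`.
[folklore] -/
theorem pairCount_constState_two (hL : 0 < L) (R : ℝ) :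
    (∫⁻ X in cellN 2 L,
        periodicInteraction (Set.indicator (Set.Iic R) (fun _ : ℝ => (1 : ℝ≥0∞))) L X *
          (‖(constState 2 hL).ψ X‖₊ : ℝ≥0∞) ^ 2) =
      volume (closedBall (0 : Space) R) * ENNReal.ofReal L ^ 3 * ENNReal.ofReal ((L ^ 3) ^ 2)⁻¹ := by
  rw [pairExpectation_constState _ hL,
    lintegral_cellN_two_periodicInteraction (measurable_indicator_const' _ measurableSet_Iic _) hL,
    lintegral_indicator_Iic_norm]

/-- **Core energy of the constant state**: `⟨Ψ, H(c₀1_{[0,r₀)}) Ψ⟩ = c₀ |B_{r₀}| · L³ · L⁻⁶`.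
[folklore] -/
theorem coreEnergy_constState_two (hL : 0 < L) (r₀ c₀ : ℝ) :
    periodicEnergy (Set.indicator (Set.Iio r₀) (fun _ : ℝ => ENNReal.ofReal c₀)) (constState 2 hL) =
      ENNReal.ofReal c₀ * volume (ball (0 : Space) r₀) * ENNReal.ofReal L ^ 3 *
        ENNReal.ofReal ((L ^ 3) ^ 2)⁻¹ := by
  rw [periodicEnergy_constState _ hL,
    lintegral_cellN_two_periodicInteraction (measurable_indicator_const' _ measurableSet_Iio _) hL,
    lintegral_indicator_Iio_norm]

/-- **The constant-state test of S1.** If the close-pair domination inequality of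
`stub_corePairDomination` holds with constant `C` for the constant two-particle state on ONE torus
of side `L > 0`, then `|B̄_R| ≤ C c₀ |B_{r₀}|`. [folklore] -/
theorem corePairDomination_constState_necessary {c₀ r₀ R C : ℝ} (hL : 0 < L) (hC : 0 ≤ C)
    (h : (∫⁻ X in cellN 2 L,
        periodicInteraction (Set.indicator (Set.Iic R) (fun _ : ℝ => (1 : ℝ≥0∞))) L X *
          (‖(constState 2 hL).ψ X‖₊ : ℝ≥0∞) ^ 2) ≤
        ENNReal.ofReal C *
          periodicEnergy (Set.indicator (Set.Iio r₀) (fun _ : ℝ => ENNReal.ofReal c₀)) (constState 2 hL)) :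
    volume (closedBall (0 : Space) R) ≤ ENNReal.ofReal (C * c₀) * volume (ball (0 : Space) r₀) := by
  rw [pairCount_constState_two, coreEnergy_constState_two] at h
  set K : ℝ≥0∞ := ENNReal.ofReal L ^ 3 * ENNReal.ofReal ((L ^ 3) ^ 2)⁻¹ with hK
  have hK0 : K ≠ 0 := by
    refine mul_ne_zero (pow_ne_zero _ ((ENNReal.ofReal_pos.2 hL).ne')) ?_
    rw [ne_eq, ENNReal.ofReal_eq_zero, not_le]
    positivity
  have hKt : K ≠ ⊤ := ENNReal.mul_ne_top (ENNReal.pow_ne_top ENNReal.ofReal_ne_top) ENNReal.ofReal_ne_top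
  have h' : volume (closedBall (0 : Space) R) * K ≤
      (ENNReal.ofReal (C * c₀) * volume (ball (0 : Space) r₀)) * K := by
    calc volume (closedBall (0 : Space) R) * K
        = volume (closedBall (0 : Space) R) * ENNReal.ofReal L ^ 3 * ENNReal.ofReal ((L ^ 3) ^ 2)⁻¹ := by
          rw [hK, mul_assoc]
      _ ≤ _ := h
      _ = (ENNReal.ofReal (C * c₀) * volume (ball (0 : Space) r₀)) * K := by
          rw [ENNReal.ofReal_mul hC, hK]; ring
  exact (ENNReal.mul_le_mul_iff_left hK0 hKt).1 h'

/-! ### Consequence 1: the admissible constant is at least `(R/r₀)³ / c₀` -/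

/-- **Tight parameter dependence of S1.** Every pair `(C, L₀)` admissible in
`stub_corePairDomination` for core height `c₀ > 0`, core radius `r₀ > 0`, counting radius `R > 0`
satisfies `(R/r₀)³ ≤ C · c₀`. [folklore] -/
theorem corePairDomination_ratio_le {c₀ r₀ R C L₀ : ℝ} (hc₀ : 0 < c₀) (hr₀ : 0 < r₀) (hR : 0 < R)
    (hC : 0 ≤ C) (hL₀ : 0 < L₀)
    (h : ∀ N : ℕ, ∀ L : ℝ, L₀ ≤ L → ∀ Ψ : PeriodicTrialState N L,
      (∫⁻ X in cellN N L,
          periodicInteraction (Set.indicator (Set.Iic R) (fun _ : ℝ => (1 : ℝ≥0∞))) L X *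
            (‖Ψ.ψ X‖₊ : ℝ≥0∞) ^ 2) ≤
        ENNReal.ofReal C *
          periodicEnergy (Set.indicator (Set.Iio r₀) (fun _ : ℝ => ENNReal.ofReal c₀)) Ψ) :
    (R / r₀) ^ 3 ≤ C * c₀ := by
  have key := corePairDomination_constState_necessary hL₀ hC (h 2 L₀ le_rfl (constState 2 hL₀))
  have hdim : Module.finrank ℝ Space = 3 := finrank_euclideanSpace_fin
  rw [Measure.addHaar_closedBall _ _ hR.le, Measure.addHaar_ball _ _ hr₀.le, hdim] at key
  have hB0 : volume (ball (0 : Space) 1) ≠ 0 := (measure_ball_pos volume (0 : Space) one_pos).ne'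
  have hBt : volume (ball (0 : Space) 1) ≠ ⊤ := measure_ball_lt_top.ne
  rw [← mul_assoc, ENNReal.mul_le_mul_iff_left hB0 hBt, ← ENNReal.ofReal_mul (by positivity),
    ENNReal.ofReal_le_ofReal_iff (by positivity)] at key
  rw [div_pow, div_le_iff₀ (by positivity)]
  linarith

/-! ### Consequence 2: without a positive core S1 is false -/

/-- `stub_corePairDomination` of `Lines/coupling-slope-pocket.lean` with the hypothesis `0 < c₀`
WEAKENED to `0 ≤ c₀`; everything else byte for byte. -/
def CorePairDominationWithoutCore : Prop :=
  ∀ c₀ r₀ R : ℝ, 0 ≤ c₀ → 0 < r₀ → 0 < R →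
    ∃ C L₀ : ℝ, 0 ≤ C ∧ 0 < L₀ ∧ ∀ N : ℕ, ∀ L : ℝ, L₀ ≤ L → ∀ Ψ : PeriodicTrialState N L,
      (∫⁻ X in cellN N L,
          periodicInteraction (Set.indicator (Set.Iic R) (fun _ : ℝ => (1 : ℝ≥0∞))) L X *
            (‖Ψ.ψ X‖₊ : ℝ≥0∞) ^ 2) ≤
        ENNReal.ofReal C *
          periodicEnergy (Set.indicator (Set.Iio r₀) (fun _ : ℝ => ENNReal.ofReal c₀)) Ψ

/-- **The positive core is load-bearing in S1**: at `c₀ = 0` the right-hand side is `C` times the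
kinetic energy, the constant two-particle state has none, yet it has `|B̄_R|/L³ > 0` expected close
pairs. So `CorePairDominationWithoutCore` is false; any proof of S1 must use `0 < c₀` (Lee's
pigeonhole branch `k ≥ 2M`), and nothing of the kind is available on the coreless class of S5.
[folklore] -/
theorem corePairDomination_false_without_core : ¬ CorePairDominationWithoutCore := by
  intro h
  obtain ⟨C, L₀, hC, hL₀, h⟩ := h 0 1 1 le_rfl one_pos one_pos
  have key := corePairDomination_constState_necessary hL₀ hC (h 2 L₀ le_rfl (constState 2 hL₀))
  rw [mul_zero, ENNReal.ofReal_zero, zero_mul, nonpos_iff_eq_zero] at key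
  exact (measure_closedBall_pos volume (0 : Space) one_pos).ne' key


/-! ### Consequence 3: for `R < r₀` S1 is trivial with the constant `1/c₀` — the bound above is sharp -/

/-- Pointwise: `1{r ≤ R} ≤ c₀⁻¹ · (c₀ 1{r < r₀})` when `R < r₀`, `c₀ > 0`. [folklore] -/
theorem indicator_Iic_le_inv_mul_indicator_Iio {c₀ r₀ R : ℝ} (hc₀ : 0 < c₀) (hR : R < r₀) (r : ℝ) :
    Set.indicator (Set.Iic R) (fun _ : ℝ => (1 : ℝ≥0∞)) r ≤
      (ENNReal.ofReal c₀)⁻¹ * Set.indicator (Set.Iio r₀) (fun _ : ℝ => ENNReal.ofReal c₀) r := by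
  by_cases hr : r ≤ R
  · have hr' : r ∈ Set.Iio r₀ := lt_of_le_of_lt hr hR
    rw [Set.indicator_of_mem (show r ∈ Set.Iic R from hr), Set.indicator_of_mem hr',
      ENNReal.inv_mul_cancel (by simpa using hc₀) ENNReal.ofReal_ne_top]
  · rw [Set.indicator_of_notMem (show r ∉ Set.Iic R from hr)]
    exact zero_le

/-- The periodisation is monotone and commutes with constant factors: if `w ≤ c · u` pointwise then
`w^per ≤ c · u^per`. [folklore] -/
theorem periodizedPotential_le_const_mul {w u : ℝ → ℝ≥0∞} {c : ℝ≥0∞} (h : ∀ r, w r ≤ c * u r)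
    (L : ℝ) (y : Space) : periodizedPotential w L y ≤ c * periodizedPotential u L y := by
  unfold periodizedPotential
  rw [← ENNReal.tsum_mul_left]
  exact ENNReal.tsum_le_tsum fun n => h _

/-- Same for the pair sum `∑_{i<j}`. [folklore] -/
theorem periodicInteraction_le_const_mul {w u : ℝ → ℝ≥0∞} {c : ℝ≥0∞} (h : ∀ r, w r ≤ c * u r)
    (L : ℝ) (X : Config N) : periodicInteraction w L X ≤ c * periodicInteraction u L X := by
  unfold periodicInteraction
  rw [Finset.mul_sum]
  refine Finset.sum_le_sum fun i _ => ?_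
  rw [Finset.mul_sum]
  exact Finset.sum_le_sum fun j _ => periodizedPotential_le_const_mul h L _

/-- **S1 below the core radius is trivial, with the sharp constant.** If the counting radius is
smaller than the core radius (`R < r₀`), every close pair is a core pair and pays `c₀`: the
inequality of `stub_corePairDomination` holds with `C = 1/c₀` for EVERY `N`, `L` and `Ψ` (kinetic
energy discarded). Together with `corePairDomination_ratio_le` (`C ≥ (R/r₀)³/c₀`, `R/r₀ ↑ 1`): the
constant-state bound is sharp at `R = r₀⁻`, and the whole content of S1 lies in the regime `R > r₀`
(close pairs OUTSIDE the core, which only kinetic energy can pay for — Lee's two-body Neumann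
branch). A positive instance of a stub, not of a Theses statement. [folklore] -/
theorem corePairDomination_of_radius_lt_core {c₀ r₀ R : ℝ} (hc₀ : 0 < c₀) (hR : R < r₀)
    (N : ℕ) (L : ℝ) (Ψ : PeriodicTrialState N L) :
    (∫⁻ X in cellN N L,
        periodicInteraction (Set.indicator (Set.Iic R) (fun _ : ℝ => (1 : ℝ≥0∞))) L X *
          (‖Ψ.ψ X‖₊ : ℝ≥0∞) ^ 2) ≤
      ENNReal.ofReal (1 / c₀) *
        periodicEnergy (Set.indicator (Set.Iio r₀) (fun _ : ℝ => ENNReal.ofReal c₀)) Ψ := by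
  rw [one_div, ENNReal.ofReal_inv_of_pos hc₀]
  unfold periodicEnergy
  rw [← lintegral_const_mul' _ _ (ENNReal.inv_ne_top.2 (by simpa using hc₀))]
  refine lintegral_mono fun X => ?_
  calc periodicInteraction (Set.indicator (Set.Iic R) (fun _ : ℝ => (1 : ℝ≥0∞))) L X *
          (‖Ψ.ψ X‖₊ : ℝ≥0∞) ^ 2
      ≤ ((ENNReal.ofReal c₀)⁻¹ *
          periodicInteraction (Set.indicator (Set.Iio r₀) (fun _ : ℝ => ENNReal.ofReal c₀)) L X) *
          (‖Ψ.ψ X‖₊ : ℝ≥0∞) ^ 2 :=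
        mul_le_mul' (periodicInteraction_le_const_mul
          (indicator_Iic_le_inv_mul_indicator_Iio hc₀ hR) L X) le_rfl
    _ = (ENNReal.ofReal c₀)⁻¹ *
          (periodicInteraction (Set.indicator (Set.Iio r₀) (fun _ : ℝ => ENNReal.ofReal c₀)) L X *
            (‖Ψ.ψ X‖₊ : ℝ≥0∞) ^ 2) := by ring
    _ ≤ (ENNReal.ofReal c₀)⁻¹ *
          (kineticDensity Ψ.ψ X +
            periodicInteraction (Set.indicator (Set.Iio r₀) (fun _ : ℝ => ENNReal.ofReal c₀)) L X *
              (‖Ψ.ψ X‖₊ : ℝ≥0∞) ^ 2) := by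
        gcongr
        exact le_add_self

end Summit.AtomisticToContinuum.BoseEinsteinCondensation.Theorems.PuffFloor.Negative

end
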